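import Mathlib.NumberTheory.Padics.RingHoms
import Mathlib.NumberTheory.LegendreSymbol.Basic
import Mathlib.Tactic.NormNum.Prime
import Mathlib.RingTheory.LocalRing.ResidueField.Basic
import Summits.Ventures.DiscreteObjects.UnitDistance.ValuationRingReduction
import HarnessLib

/-!
# The `p`-adic form of the field obstruction: `χ(ℚ_p²) ≤ χ(UD(F_p²))` for `p ≡ 3 (mod 4)` (Madore, arXiv:1509.07023, Remark 3.4), hypothesis-free

Framing (verbatim for the cell): lottery ticket; floor = certified bounds/negative ranges.

`ValuationRingReduction.lean` (p238102) proves Madore's reduction principle for an arbitrary field with a valuation ring whose residue field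
has `−1` a non-square, leaving as the only hypothesis a ring homomorphism `ResidueField O →+* ZMod p`.  Here that hypothesis is DISCHARGED
for the universal example: `K = ℚ_[p]`, `O = ℤ_[p]` (as a `ValuationSubring ℚ_[p]`: `‖x‖ ≤ 1` or `‖x⁻¹‖ ≤ 1`), residue field `≅ ZMod p`
(Mathlib's `PadicInt.residueField`).  Results, with NO hypotheses beyond the coordinatisation:

* `colorable_of_padic` — for a prime `p` with `p % 4 = 3`, every graph whose vertices carry coordinates in `ℚ_[p] × ℚ_[p]` with adjacent
  vertices at unit distance is `n`-colourable whenever `unitCircleGraph (ZMod p)` is (Madore Remark 3.4: `χ(ℚ_p²) ≤ χ(F_p²)`);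
* `colorable_three_of_padic3`, `colorable_four_of_padic7`, `colorable_five_of_padic11`, `colorable_five_of_padic19` — the four killer
  primes of the census atlas (kernel colourings of `FiniteFieldColourings.lean` / `FiniteFieldObstruction.lean`): `3`, `4`, `5`, `5` colours;
* `colorable_of_ringHom_padic` — the same for any field (or commutative ring) `K` with a ring homomorphism `K →+* ℚ_[p]`, e.g. every
  number field with an UNRAMIFIED prime of residue degree one over `p` (it embeds in its completion `ℚ_p`): `ℚ(√3,√5) ↪ ℚ_11`
  (`3 ≡ 5²`, `5 ≡ 4² (mod 11)`), `ℚ(√5,√7) ↪ ℚ_19`, `ℚ(√2) ↪ ℚ_7`, `ℚ(√13) ↪ ℚ_3`, …  So 'no 6-chromatic unit-distance graph has all its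
  coordinates in a subfield of `ℚ_3`, `ℚ_7`, `ℚ_11` or `ℚ_19`' is now a kernel theorem; by the cell's atlas (TABLE-U3/U4/U5) these are the
  ONLY primes for which the `p`-adic plane is `5`-colourable by this argument (`χ(UD(F_p²)) ≥ 6` certified for every other `p ≡ 3 (mod 4)`).
  CAVEAT (ramified primes): a RAMIFIED degree-one prime — Heule's/Parts' field `ℚ(√3,√5,√11)` at `11`, `ℚ(√3)` at `3` (Madore Prop. 4.1) —
  completes to a ramified quadratic extension `ℚ_p(√(p·u))`, NOT to `ℚ_p`; its valuation ring still has residue field `F_p`, so that case is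
  `ValuationRingReduction.colorable_five_of_valuationSubring_zmod11` (resp. `…_zmod3`) applied to that valuation ring, which this file
  does not construct.  (Correction of the first accepted version's docstring, which wrongly listed `ℚ(√3,√5,√11) ↪ ℚ_11`.)
-/

noncomputable section

namespace Summit.Ventures.DiscreteObjects.UnitDistance

open SimpleGraph IsLocalRing

variable (p : ℕ) [hp : Fact p.Prime]

/-- `3` is prime (instance for `ℚ_[3]`). -/
instance factNatPrime3 : Fact (Nat.Prime 3) := ⟨by norm_num⟩
/-- `7` is prime (instance for `ℚ_[7]`). -/
instance factNatPrime7 : Fact (Nat.Prime 7) := ⟨by norm_num⟩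
/-- `11` is prime (instance for `ℚ_[11]`). -/
instance factNatPrime11 : Fact (Nat.Prime 11) := ⟨by norm_num⟩
/-- `19` is prime (instance for `ℚ_[19]`). -/
instance factNatPrime19 : Fact (Nat.Prime 19) := ⟨by norm_num⟩

/-- `ℤ_[p] ⊂ ℚ_[p]` as a valuation subring: every `x ∈ ℚ_[p]` has `‖x‖ ≤ 1` or `‖x⁻¹‖ ≤ 1`. -/
def padicValuationSubring : ValuationSubring ℚ_[p] :=
  { PadicInt.subring p with
    mem_or_inv_mem' := by
      intro x
      by_cases hx : ‖x‖ ≤ 1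
      · exact Or.inl hx
      · right
        show ‖x⁻¹‖ ≤ 1
        rw [norm_inv]
        exact inv_le_one_of_one_le₀ (le_of_lt (not_le.mp hx)) }

/-- Membership in the `p`-adic valuation subring is `‖x‖ ≤ 1`. -/
theorem mem_padicValuationSubring_iff {x : ℚ_[p]} : x ∈ padicValuationSubring p ↔ ‖x‖ ≤ 1 := Iff.rfl

/-- The valuation subring IS `ℤ_[p]` (same carrier, same ring structure): the tautological ring isomorphism. -/
def padicValuationSubringEquiv : padicValuationSubring p ≃+* ℤ_[p] where
  toFun x := ⟨x.1, x.2⟩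
  invFun z := ⟨z.1, z.2⟩
  left_inv _ := rfl
  right_inv _ := rfl
  map_mul' _ _ := rfl
  map_add' _ _ := rfl

/-- The residue field of the `p`-adic valuation subring maps (isomorphically) to `ZMod p`. -/
def padicResidueToZMod : ResidueField (padicValuationSubring p) →+* ZMod p :=
  (PadicInt.residueField.toRingHom).comp (ResidueField.mapEquiv (padicValuationSubringEquiv p)).toRingHom

/-- For `p % 4 = 3`, `−1` is not a square in `ZMod p` (Mathlib: `ZMod.mod_four_ne_three_of_sq_eq_neg_one`). -/
theorem zmod_sq_ne_neg_one_of_mod_four (h4 : p % 4 = 3) : ∀ z : ZMod p, z ^ 2 ≠ -1 :=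
  fun _ hz => ZMod.mod_four_ne_three_of_sq_eq_neg_one hz h4

/-- Hence `−1` is not a square in the residue field of `ℤ_[p] ⊂ ℚ_[p]` for `p % 4 = 3`. -/
theorem padicResidue_sq_ne_neg_one (h4 : p % 4 = 3) : ∀ z : ResidueField (padicValuationSubring p), z ^ 2 ≠ -1 :=
  sq_ne_neg_one_of_ringHom (padicResidueToZMod p) (zmod_sq_ne_neg_one_of_mod_four p h4)

section Graph

variable {V : Type*} {G : SimpleGraph V}

/-- MADORE REMARK 3.4, HYPOTHESIS-FREE: for a prime `p ≡ 3 (mod 4)`, every graph coordinatised in `ℚ_[p]²` with unit-distance edges is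
`n`-colourable as soon as `unitCircleGraph (ZMod p)` is — `χ(ℚ_p²) ≤ χ(UD(F_p²))`. -/
theorem colorable_of_padic (h4 : p % 4 = 3) (q : V → ℚ_[p] × ℚ_[p])
    (hadj : ∀ ⦃v w : V⦄, G.Adj v w → ((q v).1 - (q w).1) ^ 2 + ((q v).2 - (q w).2) ^ 2 = 1) {n : ℕ}
    (hZ : (unitCircleGraph (ZMod p)).Colorable n) : G.Colorable n :=
  colorable_of_valuationSubring_of_ringHom (padicValuationSubring p) q (padicResidue_sq_ne_neg_one p h4) hadj
    (padicResidueToZMod p) hZ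

/-- Transport along a ring homomorphism into `ℚ_[p]` (e.g. a number field with a degree-one prime over `p`, embedded in its completion):
coordinates in `K` with unit-distance edges ⇒ `n`-colourable whenever `unitCircleGraph (ZMod p)` is. -/
theorem colorable_of_ringHom_padic (h4 : p % 4 = 3) {K : Type*} [CommRing K] (ι : K →+* ℚ_[p]) (q : V → K × K)
    (hadj : ∀ ⦃v w : V⦄, G.Adj v w → ((q v).1 - (q w).1) ^ 2 + ((q v).2 - (q w).2) ^ 2 = 1) {n : ℕ}
    (hZ : (unitCircleGraph (ZMod p)).Colorable n) : G.Colorable n := by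
  refine colorable_of_padic p h4 (fun v => (ι (q v).1, ι (q v).2)) ?_ hZ
  intro v w hvw
  have := congrArg ι (hadj hvw)
  simpa only [map_add, map_pow, map_sub, map_one] using this

/-- `p = 3`: every unit-distance graph coordinatised in `ℚ_[3]²` is `3`-colourable (`χ(ℚ_3²) ≤ 3`; fields: `ℚ(√3) ⊂ ℚ_3(√3)` is Madore
Prop. 4.1 — here the unramified version, e.g. `ℚ(√7)`, `ℚ(√13)`, `ℚ(√3·…)`-free fields with a split prime over 3). -/
theorem colorable_three_of_padic3 (q : V → ℚ_[3] × ℚ_[3])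
    (hadj : ∀ ⦃v w : V⦄, G.Adj v w → ((q v).1 - (q w).1) ^ 2 + ((q v).2 - (q w).2) ^ 2 = 1) : G.Colorable 3 :=
  colorable_of_padic 3 (by decide) q hadj unitCircleGraph_zmod3_colorable_three

/-- `p = 7`: every unit-distance graph coordinatised in `ℚ_[7]²` is `4`-colourable (`χ(ℚ_7²) ≤ 4`; `ℚ(√2)`, `ℚ(√11)`, `ℚ(√2,√7,√11)`, …). -/
theorem colorable_four_of_padic7 (q : V → ℚ_[7] × ℚ_[7])
    (hadj : ∀ ⦃v w : V⦄, G.Adj v w → ((q v).1 - (q w).1) ^ 2 + ((q v).2 - (q w).2) ^ 2 = 1) : G.Colorable 4 :=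
  colorable_of_padic 7 (by decide) q hadj unitCircleGraph_zmod7_colorable_four

/-- `p = 11` (hypothesis-free): every unit-distance graph coordinatised in `ℚ_[11]²` is `5`-colourable — `χ(ℚ_11²) ≤ 5`; no 6-chromatic
unit-distance graph has all coordinates in a subfield of `ℚ_11` (e.g. `ℚ(√3,√5)`, `ℚ(√5)`, and `ℚ(√3,√5,√d)` for any integer `d` that is a non-zero
square mod 11).  Heule's/Parts' field `ℚ(√3,√5,√11)` is RAMIFIED at 11 and embeds in `ℚ_11(√11)`, not in `ℚ_11`: for it use
`ValuationRingReduction.lean` with the valuation ring of `ℚ_11(√11)` (residue field `F_11`), or `CoordRingObstruction.lean`. -/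
theorem colorable_five_of_padic11 (q : V → ℚ_[11] × ℚ_[11])
    (hadj : ∀ ⦃v w : V⦄, G.Adj v w → ((q v).1 - (q w).1) ^ 2 + ((q v).2 - (q w).2) ^ 2 = 1) : G.Colorable 5 :=
  colorable_of_padic 11 (by decide) q hadj unitCircleGraph_zmod11_colorable_five

/-- `p = 19`: every unit-distance graph coordinatised in `ℚ_[19]²` is `5`-colourable — `χ(ℚ_19²) ≤ 5` (`ℚ(√5,√7)`, `ℚ(√5,√7,√11)`, …). -/
theorem colorable_five_of_padic19 (q : V → ℚ_[19] × ℚ_[19])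
    (hadj : ∀ ⦃v w : V⦄, G.Adj v w → ((q v).1 - (q w).1) ^ 2 + ((q v).2 - (q w).2) ^ 2 = 1) : G.Colorable 5 :=
  colorable_of_padic 19 (by decide) q hadj unitCircleGraph_zmod19_colorable_five

end Graph

/-- The `p`-adic plane itself: `unitCircleGraph ℚ_[p]` is `n`-colourable whenever `unitCircleGraph (ZMod p)` is (`p % 4 = 3`). -/
theorem unitCircleGraph_padic_colorable (h4 : p % 4 = 3) {n : ℕ} (hZ : (unitCircleGraph (ZMod p)).Colorable n) :
    (unitCircleGraph ℚ_[p]).Colorable n :=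
  colorable_of_padic p h4 (G := unitCircleGraph ℚ_[p]) id (fun _ _ h => h.2) hZ

/-- `χ(ℚ_11²) ≤ 5`: the unit-distance graph of the 11-adic plane is 5-colourable. -/
theorem unitCircleGraph_padic11_colorable_five : (unitCircleGraph ℚ_[11]).Colorable 5 :=
  unitCircleGraph_padic_colorable 11 (by decide) unitCircleGraph_zmod11_colorable_five

/-- `χ(ℚ_19²) ≤ 5`. -/
theorem unitCircleGraph_padic19_colorable_five : (unitCircleGraph ℚ_[19]).Colorable 5 :=
  unitCircleGraph_padic_colorable 19 (by decide) unitCircleGraph_zmod19_colorable_five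

/-- `χ(ℚ_7²) ≤ 4`. -/
theorem unitCircleGraph_padic7_colorable_four : (unitCircleGraph ℚ_[7]).Colorable 4 :=
  unitCircleGraph_padic_colorable 7 (by decide) unitCircleGraph_zmod7_colorable_four

/-- `χ(ℚ_3²) ≤ 3`. -/
theorem unitCircleGraph_padic3_colorable_three : (unitCircleGraph ℚ_[3]).Colorable 3 :=
  unitCircleGraph_padic_colorable 3 (by decide) unitCircleGraph_zmod3_colorable_three

end Summit.Ventures.DiscreteObjects.UnitDistance

end
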